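import Literature.Geometry.Manifold.DeRhamProductDefect
import HarnessLib

/-!
# Multiplicativity of the de Rham comparison for external products: the case of `0`-forms

In the setting of `DeRhamProductDefect.lean` (manifolds `M`, `N`; a closed `l`-form `β` on `N`;
an open set `W ⊆ M`) we prove that the two sides agree on classes of form-degree `0`:

  `lhs N hW β 0 l h a = rhs N hW β 0 l h a`  (`lhs_eq_rhs_of_degree_zero`).

A class of degree `0` is a closed `0`-form `f` on `W`, i.e. a function constant along smooth paths
in `W` (the cocycle condition of the smooth cochain `Ψ_W f` on a smooth `1`-simplex,
`apply_eq_of_d_eq_zero_of_isSmooth`), in particular constant on the image of every smooth simplex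
in `W` (`apply_eq_apply_vertex_of_mem_range`).  Testing against the restriction to smooth chains
of `π₁⁻¹ W` (injective on cohomology, Bredon (1993), Thm. V.9.5) both sides become explicit smooth
cochains: on a smooth `l`-simplex `σ` of `π₁⁻¹ W` the left-hand side is
`∫_σ π₁^* f · π₂^* β = f(σ(v₀)) ∫_{π₂ ∘ σ} β` (the factor `f ∘ π₁` is constant on the image of `σ`),
and the right-hand side is `f(σ(v₀)) · b_β(π₂ ∘ σ)` (Alexander–Whitney formula, Hatcher (2002),
§3.2), where the good representative `b_β` takes the value `∫_{π₂ ∘ σ} β` on the smooth simplex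
`π₂ ∘ σ` (`goodFun_apply_of_isSmooth`).

Everything is proved; no named facts.

## References

* [Bredon1993] G. E. Bredon, *Topology and Geometry*, GTM 139 (1993), §V.5, §V.9 Thm. V.9.5.
* [HatcherAT2002] A. Hatcher, *Algebraic Topology*, CUP 2002, §3.2 p. 206.
* [LeeSmoothManifolds2013] J. M. Lee, *Introduction to Smooth Manifolds*, 2nd ed., Prop. 18.9.
-/

noncomputable section

-- see "Implementation notes" in `…SingularHomology.SingularChainsConcrete`
set_option backward.isDefEq.respectTransparency false

open scoped Manifold ContDiff Topology
open CategoryTheory Limits Set Literature.AlgebraicTopology.SingularHomology Literature.Geometry.Kaehler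

universe u

namespace Literature.Geometry.Manifold

variable {E : Type u} [NormedAddCommGroup E] [NormedSpace ℝ E] {H : Type u} [TopologicalSpace H]
  {I : ModelWithCorners ℝ E H} {M : Type u} [TopologicalSpace M] [ChartedSpace H M]

/-! ### Points of simplices -/

/-- The point of the front `0`-face of a simplex is its vertex `v₀`. [folklore] -/
theorem toContinuousMap_frontFace_default {n : ℕ} (h : 0 ≤ n) (σ : SingularSimplex M n) :
    SingularSimplex.toContinuousMap (σ.frontFace h) default = SingularSimplex.toContinuousMap σ (stdSimplex.vertex 0) := by
  rw [SingularSimplex.frontFace_eq_compose_subinterval, SingularSimplex.toContinuousMap_compose, ContinuousMap.comp_apply,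
    StdSimplex.affMap_apply, Subsingleton.elim (default : StdSimplex 0) (stdSimplex.vertex 0), StdSimplex.affComb_vertex]
  congr 2

/-- The two vertices of the `1`-simplex `σ ∘ [v₀, t]`. [folklore] -/
theorem toContinuousMap_compose_vecCons_vertex {n : ℕ} (σ : SingularSimplex M n) (s t : StdSimplex n) (j : Fin 2) :
    SingularSimplex.toContinuousMap (σ.compose ![s, t]) (stdSimplex.vertex j) =
      SingularSimplex.toContinuousMap σ (![s, t] j) := by
  rw [SingularSimplex.toContinuousMap_compose, ContinuousMap.comp_apply, StdSimplex.affMap_apply, StdSimplex.affComb_vertex]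

/-- The point of a face of a `1`-simplex. [folklore] -/
theorem toContinuousMap_face_default_one (γ : SingularSimplex M 1) (i : Fin 2) :
    SingularSimplex.toContinuousMap (γ.face i) default = SingularSimplex.toContinuousMap γ (stdSimplex.vertex (Fin.succAbove i 0)) := by
  rw [SingularSimplex.toContinuousMap_face, ContinuousMap.comp_apply,
    Subsingleton.elim (default : StdSimplex 0) (stdSimplex.vertex 0)]
  change SingularSimplex.toContinuousMap γ (stdSimplex.map (Fin.succAbove i) (stdSimplex.vertex 0)) = _
  rw [stdSimplex.map_vertex]

/-! ### Closed `0`-forms are constant along smooth simplices -/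

section ZeroForms

variable [IsManifold I ∞ M] {W : Set M} (hW : IsOpen W)

/-- The function cochain of `Ψ_W η` on a smooth simplex in `W` is `∫_σ η`. [folklore] -/
theorem toFun_deRhamMap (k : ℕ) (η : (localDeRhamComplex I ℝ hW).X k) {σ : SingularSimplex M k}
    (hσ : σ ∈ (smoothSpan I W).carrier k) :
    (smoothSpan I W).toFun ((deRhamMap I hW).f k η) σ = σ.formIntegral (η.1 : MForm I M ℝ k) := by
  rw [(smoothSpan I W).toFun_apply_of_mem _ hσ]
  change cochainVal ((deRhamMap I hW).f k η) ⟨Finsupp.single σ 1, _⟩ = _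
  rw [deRhamMap_cochainVal]
  change integrationFunctional (η.1 : MForm I M ℝ k) (Finsupp.single σ 1) = _
  rw [integrationFunctional_single, one_mul]

/-- The function cochain of `Ψ_W f` on a `0`-simplex in `W` is the value of `f` at its point. [folklore] -/
theorem toFun_deRhamMap_zero (f : (localDeRhamComplex I ℝ hW).X 0) {ρ : SingularSimplex M 0}
    (hρ : ρ ∈ (smoothSpan I W).carrier 0) :
    (smoothSpan I W).toFun ((deRhamMap I hW).f 0 f) ρ =
      (f.1 : MForm I M ℝ 0) (SingularSimplex.toContinuousMap ρ default) Fin.elim0 := by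
  rw [toFun_deRhamMap hW 0 f hρ, SingularSimplex.formIntegral_eq_of_zero]

/-- **A closed `0`-form on `W` takes the same value at the two end points of a smooth `1`-simplex in
`W`**: the cocycle condition of the smooth cochain `Ψ_W f` on the simplex (`Ψ_W` is a chain map).
[cite: Bredon1993, §V.5] -/
theorem apply_eq_of_d_eq_zero_of_isSmooth (f : (localDeRhamComplex I ℝ hW).X 0)
    (hf : (localDeRhamComplex I ℝ hW).d 0 1 f = 0) {γ : SingularSimplex M 1} (hγ : γ.IsSmooth I) (hγW : γ.range ⊆ W) :
    (f.1 : MForm I M ℝ 0) (SingularSimplex.toContinuousMap γ (stdSimplex.vertex 1)) Fin.elim0 =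
      (f.1 : MForm I M ℝ 0) (SingularSimplex.toContinuousMap γ (stdSimplex.vertex 0)) Fin.elim0 := by
  set ψ := (deRhamMap I hW).f 0 f
  have hψ : (smoothSpan I W).cochains.d 0 1 ψ = 0 := by
    change (smoothSubsetCochains I ℝ realCoeff.{u} M W).d 0 1 ((deRhamMap I hW).f 0 f) = 0
    rw [← ModuleCat.comp_apply, (deRhamMap I hW).comm 0 1, ModuleCat.comp_apply, hf, map_zero]
  have hmem : γ ∈ (smoothSpan I W).carrier 1 := ⟨hγ, hγW⟩
  have key := (smoothSpan I W).toFun_d ψ hmem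
  rw [hψ, SimplexSpan.toFun_zero, Pi.zero_apply, singularCochainComplex.d_apply, Fin.sum_univ_two] at key
  simp only [Fin.val_zero, pow_zero, one_smul, Fin.val_one, pow_one, neg_smul, one_smul] at key
  rw [toFun_deRhamMap_zero hW f ((smoothSpan I W).face_mem' hmem 0),
    toFun_deRhamMap_zero hW f ((smoothSpan I W).face_mem' hmem 1), toContinuousMap_face_default_one,
    toContinuousMap_face_default_one] at key
  have h0 : Fin.succAbove (0 : Fin 2) 0 = 1 := rfl
  have h1 : Fin.succAbove (1 : Fin 2) 0 = 0 := rfl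
  rw [h0, h1] at key
  linarith

/-- **A closed `0`-form on `W` is constant on the image of a smooth simplex in `W`** (join a point of
the simplex to the vertex `v₀` by the straight segment in `Δⁿ`, a smooth `1`-simplex in `W`).
[cite: Bredon1993, §V.5] -/
theorem apply_eq_apply_vertex_of_isSmooth (f : (localDeRhamComplex I ℝ hW).X 0)
    (hf : (localDeRhamComplex I ℝ hW).d 0 1 f = 0) {n : ℕ} {σ : SingularSimplex M n} (hσ : σ.IsSmooth I)
    (hσW : σ.range ⊆ W) (t : StdSimplex n) :
    (f.1 : MForm I M ℝ 0) (SingularSimplex.toContinuousMap σ t) Fin.elim0 =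
      (f.1 : MForm I M ℝ 0) (SingularSimplex.toContinuousMap σ (stdSimplex.vertex 0)) Fin.elim0 := by
  have h := apply_eq_of_d_eq_zero_of_isSmooth hW f hf (hσ.compose ![stdSimplex.vertex 0, t])
    ((σ.range_compose_subset _).trans hσW)
  rwa [toContinuousMap_compose_vecCons_vertex, toContinuousMap_compose_vecCons_vertex] at h

/-- The same, for a point of the image. [cite: Bredon1993, §V.5] -/
theorem apply_eq_apply_vertex_of_mem_range (f : (localDeRhamComplex I ℝ hW).X 0)
    (hf : (localDeRhamComplex I ℝ hW).d 0 1 f = 0) {n : ℕ} {σ : SingularSimplex M n} (hσ : σ.IsSmooth I)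
    (hσW : σ.range ⊆ W) {x : M} (hx : x ∈ σ.range) :
    (f.1 : MForm I M ℝ 0) x Fin.elim0 =
      (f.1 : MForm I M ℝ 0) (SingularSimplex.toContinuousMap σ (stdSimplex.vertex 0)) Fin.elim0 := by
  obtain ⟨t, rfl⟩ := hx
  exact apply_eq_apply_vertex_of_isSmooth hW f hf hσ hσW t

end ZeroForms

/-! ### The external product with a `0`-form, pointwise -/

section Pointwise

variable {E' : Type u} [NormedAddCommGroup E'] [NormedSpace ℝ E'] {H' : Type u} [TopologicalSpace H']
  {I' : ModelWithCorners ℝ E' H'} {N : Type u} [TopologicalSpace N] [ChartedSpace H' N] {l : ℕ}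

/-- **`(f ⊠ β)(x, y) = f(x) · (π₂^* β)(x, y)` for a `0`-form `f`** (a `0`-form as a wedge factor is a
scalar, Warner (1983), 2.6). [cite: WarnerGTM94, 2.6] -/
theorem castDeg_extProd_zero_apply (f : MForm I M ℝ 0) (β : MForm I' N ℝ l) (h : 0 + l = l) (p : M × N) :
    ((f.extProd β).castDeg h) p = (f p.1 Fin.elim0) • (β.pullback (I.prod I') (Prod.snd : M × N → N)) p := by
  have hpull : f.pullback (I.prod I') (Prod.fst : M × N → M) = MForm.ofFun (I.prod I') (fun q : M × N ↦ f q.1 Fin.elim0) := by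
    funext q
    ext w
    rw [MForm.pullback_apply, MForm.ofFun_apply]
    exact congrArg (f q.1) (funext fun i ↦ i.elim0)
  have hx : f.extProd β = MForm.castDeg (Nat.zero_add l).symm
      (fun q : M × N ↦ (f q.1 Fin.elim0) • (β.pullback (I.prod I') (Prod.snd : M × N → N)) q) := by
    rw [MForm.extProd_def, hpull, MForm.ofFun_wedge]
  ext v
  rw [MForm.castDeg_apply, hx, MForm.castDeg_apply]
  congr 1

end Pointwise

/-! ### The degree-`0` case of the multiplicativity -/

section DegreeZero

variable [IsManifold I ∞ M] [I.Boundaryless] [FiniteDimensional ℝ E] [T2Space M] [SecondCountableTopology M]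
  [LocallyCompactSpace M]
  {E' : Type u} [NormedAddCommGroup E'] [NormedSpace ℝ E'] {H' : Type u} [TopologicalSpace H']
  {I' : ModelWithCorners ℝ E' H'} {N : Type u} [TopologicalSpace N] [ChartedSpace H' N] [IsManifold I' ∞ N]
  [I'.Boundaryless] [FiniteDimensional ℝ E'] [T2Space N] [SecondCountableTopology N] [LocallyCompactSpace N]
  {l : ℕ} {W : Set M} (hW : IsOpen W) (β : closedSmoothForms I' N ℝ l)

omit [I.Boundaryless] [FiniteDimensional ℝ E] [T2Space M] [SecondCountableTopology M] [LocallyCompactSpace M] in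
/-- **The two smooth cochains agree**: on the smooth chains of `π₁⁻¹ W`,
`Ψ (π₁^* f ∧ π₂^* β) = Ψ(π₁^* f) ⌣ π₂^♯ b_β` for a closed `0`-form `f` on `W`.
[cite: Bredon1993, Thm. V.9.5] [cite: HatcherAT2002, §3.2 p. 206] -/
theorem deRhamMap_extProdMap_zero (h : 0 + l = l) (f : (localDeRhamComplex I ℝ hW).X 0)
    (hf : (localDeRhamComplex I ℝ hW).d 0 1 f = 0) :
    (deRhamMap (I.prod I') (isOpen_preimage_fst (N := N) hW)).f l
        ((localDeRhamComplex.extProdMap N hW β).app 0 l h f) =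
      (smoothSpan (I.prod I') (Prod.fst ⁻¹' W : Set (M × N))).cupRight (prodFun M β) h
        ((deRhamMap (I.prod I') (isOpen_preimage_fst (N := N) hW)).f 0
          ((localDeRhamComplex.pullbackPair (I.prod I') contMDiff_fst (isOpen_preimage_fst (N := N) hW) hW
            (mapsTo_preimage Prod.fst W)).f 0 f)) := by
  refine (smoothSpan (I.prod I') (Prod.fst ⁻¹' W : Set (M × N))).hom_ext_toFun fun σ hσ ↦ ?_
  rw [toFun_deRhamMap _ l _ hσ, (smoothSpan (I.prod I') _).toFun_cupRight_eq _ h _ hσ, SingularSimplex.backFace_self,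
    toFun_deRhamMap_zero _ _ ((frontBackClosed_smoothSpan _).front _ hσ), toContinuousMap_frontFace_default,
    prodFun_apply, goodFun_apply_of_isSmooth β (hσ.1.map contMDiff_snd),
    SingularSimplex.formIntegral_map hσ.1 contMDiff_snd]
  -- the point `σ(v₀)` lies in `π₁⁻¹ W`, and `f ∘ π₁` is constant on the image of `σ`
  set p₀ : M × N := SingularSimplex.toContinuousMap σ (stdSimplex.vertex 0) with hp₀
  have hp₀W : p₀ ∈ (Prod.fst ⁻¹' W : Set (M × N)) := hσ.2 ⟨_, rfl⟩
  have hconst : ∀ x ∈ σ.range, (f.1 : MForm I M ℝ 0) x.1 Fin.elim0 = (f.1 : MForm I M ℝ 0) p₀.1 Fin.elim0 := by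
    intro x hx
    have hx' : x.1 ∈ (σ.map (fstCM M N)).range := by
      rw [SingularSimplex.range_map]
      exact ⟨x, hx, rfl⟩
    have hσW : (σ.map (fstCM M N)).range ⊆ W := by
      rw [SingularSimplex.range_map]
      rintro _ ⟨y, hy, rfl⟩
      exact hσ.2 hy
    exact apply_eq_apply_vertex_of_mem_range hW f hf (hσ.1.map contMDiff_fst) hσW hx'
  -- left-hand side: `∫_σ (f ⊠ β) = f(p₀) ∫_σ π₂^* β`
  have hlhs : σ.formIntegral (((localDeRhamComplex.extProdMap N hW β).app 0 l h f).1 : MForm (I.prod I') (M × N) ℝ l) =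
      σ.formIntegral (((f.1 : MForm I M ℝ 0) p₀.1 Fin.elim0) •
        (β.1 : MForm I' N ℝ l).pullback (I.prod I') (Prod.snd : M × N → N)) := by
    refine σ.formIntegral_congr fun x hx ↦ ?_
    rw [localDeRhamComplex.extProdMap_app_coe, castDeg_extProd_zero_apply, hconst x hx]
    rfl
  rw [hlhs, SingularSimplex.formIntegral_smul, smul_eq_mul]
  congr 1
  -- right-hand side: the value of `(π₁^* f)|` at `p₀`
  rw [localDeRhamComplex.pullbackPair_f_apply_coe, MForm.restr_apply_of_mem _ hp₀W, MForm.pullback_apply]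
  exact congrArg ((f.1 : MForm I M ℝ 0) p₀.1) (funext fun i ↦ i.elim0)

/-- **Multiplicativity of the de Rham comparison for external products, form-degree `0`**:
`lhs = rhs` on `H⁰(Ω•(W))` for every open `W ⊆ M`. [cite: Bredon1993, Thm. V.9.5] -/
theorem lhs_eq_rhs_of_degree_zero {n : ℕ} (h : 0 + l = n) (a : (localDeRhamComplex I ℝ hW).homology 0) :
    lhs N hW β 0 n h a = rhs N hW β 0 n h a := by
  obtain rfl : l = n := by omega
  haveI : Fact (IsOpen (Prod.fst ⁻¹' W : Set (M × N))) := ⟨isOpen_preimage_fst (N := N) hW⟩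
  obtain ⟨f, hf, rfl⟩ := homologyCls_surjective a
  have hf' : (localDeRhamComplex I ℝ hW).d 0 1 f = 0 :=
    (d_next_eq_zero_iff ((ComplexShape.down ℕ).symm.next_eq' (rfl : 0 + 1 = 1)) _).1 hf
  -- test against the injective `H(toSmooth)`
  apply ((ConcreteCategory.isIso_iff_bijective (HomologicalComplex.homologyMap
    (smoothSubsetCochains.toSmooth (I.prod I') ℝ realCoeff.{u} (Prod.fst ⁻¹' W : Set (M × N))) l)).1 inferInstance).1
  -- the left-hand side is the class of `Ψ (f ⊠ β)`
  rw [lhs_apply, ← ModuleCat.comp_apply, localDeRhamToSubset_comp_toSmooth,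
    localDeRhamComplex.extProdH_homologyCls, homologyMap_homologyCls]
  -- the right-hand side: a representative of `π₁^* Ψ'_W [f]` is `Ψ'_{π₁⁻¹ W} [(π₁^* f)|]`
  have hy : subsetCochains.pullH (N := realCoeff.{u}) (fstCM M N) (mapsTo_preimage Prod.fst W) 0
      (localDeRhamToSubset I hW 0 (homologyCls f hf)) =
      localDeRhamToSubset (I.prod I') (isOpen_preimage_fst (N := N) hW) 0
        (HomologicalComplex.homologyMap (localDeRhamComplex.pullbackPair (I.prod I') contMDiff_fst
          (isOpen_preimage_fst (N := N) hW) hW (mapsTo_preimage Prod.fst W)) 0 (homologyCls f hf)) :=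
    (localDeRhamToSubset_pullbackPair_apply _ _ _ _ 0 _).symm
  obtain ⟨â, hâ, hcls⟩ := homologyCls_surjective (subsetCochains.pullH (N := realCoeff.{u}) (fstCM M N)
    (mapsTo_preimage Prod.fst W) 0 (localDeRhamToSubset I hW 0 (homologyCls f hf)))
  rw [rhs_apply, ← hcls, (SimplexSpan.ofSet (R := ℝ) _).cupRightH_homologyCls, homologyMap_homologyCls]
  -- in degree `0` the representative `â` restricts on smooth chains to `Ψ ((π₁^* f)|)` exactly
  have hTa : (smoothSubsetCochains.toSmooth (I.prod I') ℝ realCoeff.{u} (Prod.fst ⁻¹' W : Set (M × N))).f 0 â =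
      (deRhamMap (I.prod I') (isOpen_preimage_fst (N := N) hW)).f 0
        ((localDeRhamComplex.pullbackPair (I.prod I') contMDiff_fst (isOpen_preimage_fst (N := N) hW) hW
          (mapsTo_preimage Prod.fst W)).f 0 f) := by
    have h1 : homologyCls ((smoothSubsetCochains.toSmooth (I.prod I') ℝ realCoeff.{u} (Prod.fst ⁻¹' W : Set (M × N))).f 0 â)
        (d_hom_f_eq_zero _ â hâ) =
        HomologicalComplex.homologyMap (deRhamMap (I.prod I') (isOpen_preimage_fst (N := N) hW)) 0
          (HomologicalComplex.homologyMap (localDeRhamComplex.pullbackPair (I.prod I') contMDiff_fst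
            (isOpen_preimage_fst (N := N) hW) hW (mapsTo_preimage Prod.fst W)) 0 (homologyCls f hf)) := by
      rw [← homologyMap_homologyCls _ â hâ, hcls, hy, ← ModuleCat.comp_apply, localDeRhamToSubset_comp_toSmooth]
    rw [homologyMap_homologyCls, homologyMap_homologyCls] at h1
    obtain ⟨w, hw⟩ := (homologyCls_eq_homologyCls_iff _ _ _ _).1 h1
    have hw0 : (smoothSubsetCochains (I.prod I') ℝ realCoeff.{u} (M × N) (Prod.fst ⁻¹' W)).d
        ((ComplexShape.down ℕ).symm.prev 0) 0 w = 0 := by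
      rw [(smoothSubsetCochains (I.prod I') ℝ realCoeff.{u} (M × N) (Prod.fst ⁻¹' W)).shape _ _ (by
        simp only [ComplexShape.symm_Rel, ComplexShape.down_Rel]; omega)]
      rfl
    rw [hw0, eq_comm, sub_eq_zero] at hw
    exact hw
  refine homologyCls_congr ?_ _ _
  rw [toSmooth_cupRight, hTa]
  exact deRhamMap_extProdMap_zero hW β h f hf'

end DegreeZero

end Literature.Geometry.Manifold
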